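import Literature.Computability.AlgebraicComplexity.LowDepthRankBound
import HarnessLib

/-!
# The Limaye–Srinivasan–Tavenas rank bound in large characteristic (`char K = 0` or `> d`)

The engine of `LowDepthRankBound.lean` (`LSTWord.relRank_aeval_eval_le`: LST 2025, Claim 16 +
Prop. 9 run on the gate values of a circuit) and its algebraic input `NewtonSetMultilinear.lean`
(Newton's identities in span form) are stated over a field `K` with `[CharZero K]`. Characteristic
zero is used at exactly one point: to divide by `k` in Newton's identity
`k e_k = ∑ (-1)^{i-1} e_{k-i} p_i` for `k ≤ m = #T ≤ d` (`esymm_mem_span_psumProd_of_le`). LST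
state their result for "characteristic `0` or `> d`" (J. ACM 72 (2025), Art. 26, Cor. 4; the
set-multilinearisation of Prop. 9 / Lemma 20 needs `d!` invertible), and so does Andrews–Forbes
2022, Cor. 6.5 (`char F = 0` or `char F > d`).

This file re-runs the characteristic-dependent chain with `[CharZero K]` replaced by the explicit
hypothesis **`hK : ∀ i, 0 < i → i ≤ m → (i : K) ≠ 0`** (`m` = the relevant degree bound: `m` for
Newton, `#S` for a block set, `d` for the circuit bound) — primed names, proofs copied verbatim
from the two files with the hypothesis threaded (no statement of those files is changed; the
unprimed `[CharZero K]` theorems are the special case `hK := fun i hi _ => Nat.cast_ne_zero.2 hi.ne'`):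

* `esymm_mem_span_psumProd_of_le'`, `esymm_mem_span_psumProd'` (Newton's identities, span form);
* `smlProj_prod_one_add_mem_span_wGen'`, `smlProj_list_prod_mem_span_newtonGen'` (set-multilinear
  parts of a product gate);
* `LSTWord.relRank_prodGate_le'`, `LSTWord.iholds_succ'`, `LSTWord.iholds_Lam'`,
  **`LSTWord.relRank_aeval_eval_le'`** (the engine: `relrk_w(g(P)) ≤ Λ_Δ · 2^{-k d^{μ_Δ}/20}` for
  a product-depth-`≤ Δ` circuit `P` over any field `K` with `1, …, d` invertible).

Used by `AndrewsForbes2022BorderLST.lean` (val-lit t24) for the positive-characteristic bullet of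
Andrews–Forbes 2022, Cor. 6.5. TODO(pnp family, optional): derive the unprimed theorems of
`NewtonSetMultilinear.lean` / `LowDepthRankBound.lean` from the primed ones to remove the textual
duplication.

## References

* N. Limaye, S. Srinivasan, S. Tavenas, J. ACM 72 (2025), Art. 26, Cor. 4 ("characteristic `0` or
  `> d`"), Lemma 15, Claim 16, Lemma 20.
* R. Andrews, M. A. Forbes, STOC 2022, arXiv:2112.00792, Cor. 6.5.
-/

noncomputable section

open MvPolynomial

namespace Literature.Computability.AlgebraicComplexity

universe u v w

/-! ### Newton's identities in span form, `1, …, m` invertible -/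

section Newton

variable (K : Type u) [Field K] (n m : ℕ)

/-- **Newton's identities, span form**: over a field in which `1, …, m` are invertible, the elementary
symmetric polynomial `e_k`, `k ≤ m`, lies in the `K`-span of the power-sum products
`p_{κ_1} ⋯ p_{κ_ℓ}` with `ℓ ≤ k` (by induction on `k` from Mathlib's
`MvPolynomial.mul_esymm_eq_sum`, `k e_k = ∑_{i=1}^{k} (-1)^{i-1} e_{k-i} p_i`, dividing by `k`);
this is the expansion `WESym^d = ∑_γ κ_γ (WPow^1)^{γ_1} ⋯ (WPow^d)^{γ_d}` of LST 2025, §7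
(p. 26:19) in its unweighted form. [cite: LimayeSrinivasanTavenas2025, Lemma 20] -/
theorem esymm_mem_span_psumProd_of_le' (hK : ∀ i : ℕ, 0 < i → i ≤ m → (i : K) ≠ 0) {k : ℕ} (hk : k ≤ m) :
    esymm (Fin n) K k ∈ Submodule.span K
      {x | ∃ κ : PsumIdx m, (κ.1 : ℕ) ≤ k ∧ psumProd K n m κ = x} := by
  induction k using Nat.strong_induction_on with
  | _ k ih =>
    rcases Nat.eq_zero_or_pos k with rfl | hpos
    · rw [esymm_zero]
      refine Submodule.subset_span ⟨⟨⟨0, Nat.succ_pos m⟩, fun q => q.elim0⟩, le_rfl, ?_⟩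
      simp [psumProd]
    have hk0 : (k : K) ≠ 0 := hK k hpos hk
    have key := MvPolynomial.mul_esymm_eq_sum (Fin n) K k
    have hCk : esymm (Fin n) K k =
        (k : K)⁻¹ • ((k : MvPolynomial (Fin n) K) * esymm (Fin n) K k) := by
      rw [smul_eq_C_mul, ← mul_assoc,
        show (k : MvPolynomial (Fin n) K) = C (k : K) from (map_natCast C k).symm,
        ← map_mul, inv_mul_cancel₀ hk0, C_1, one_mul]
    have hneg : ∀ i : ℕ, ((-1 : MvPolynomial (Fin n) K) ^ i) = C ((-1 : K) ^ i) := fun i => by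
      rw [map_pow, map_neg, C_1]
    rw [hCk, key, hneg, C_mul']
    refine Submodule.smul_mem _ _ (Submodule.smul_mem _ _ (Submodule.sum_mem _ fun a ha => ?_))
    rw [Finset.mem_filter, Finset.mem_antidiagonal] at ha
    obtain ⟨hab, halt⟩ := ha
    have hsummand : (-1 : MvPolynomial (Fin n) K) ^ a.1 * esymm (Fin n) K a.1 * psum (Fin n) K a.2 =
        ((-1 : K) ^ a.1) • (psum (Fin n) K a.2 * esymm (Fin n) K a.1) := by
      rw [hneg, mul_assoc, C_mul', mul_comm (esymm (Fin n) K a.1) (psum (Fin n) K a.2)]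
    rw [hsummand]
    refine Submodule.smul_mem _ _ ?_
    -- `psum a.2 * esymm a.1`, with `esymm a.1` in the span of the products with `≤ a.1` parts
    have hmem := ih a.1 halt (by omega)
    have himg : psum (Fin n) K a.2 * esymm (Fin n) K a.1 ∈
        Submodule.span K (LinearMap.mulLeft K (psum (Fin n) K a.2) ''
          {x | ∃ κ : PsumIdx m, (κ.1 : ℕ) ≤ a.1 ∧ psumProd K n m κ = x}) := by
      rw [← Submodule.map_span]
      exact Submodule.mem_map_of_mem hmem
    refine Submodule.span_mono ?_ himg
    rintro _ ⟨_, ⟨κ, hκ, rfl⟩, rfl⟩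
    obtain ⟨⟨ℓ, hℓ⟩, κ⟩ := κ
    simp only at hκ
    -- append the part `a.2`
    refine ⟨⟨⟨ℓ + 1, by omega⟩, Fin.snoc κ ⟨a.2, by omega⟩⟩, by simp only; omega, ?_⟩
    rw [LinearMap.mulLeft_apply, psumProd, psumProd, Fin.prod_univ_castSucc]
    simp only [Fin.snoc_castSucc, Fin.snoc_last]
    ring

/-- Newton's identities, span form over the full index family `PsumIdx m`: for `k ≤ m`,
`e_k ∈ span_K (range psumProd)`. [cite: LimayeSrinivasanTavenas2025, Lemma 20] -/
theorem esymm_mem_span_psumProd' (hK : ∀ i : ℕ, 0 < i → i ≤ m → (i : K) ≠ 0) {k : ℕ} (hk : k ≤ m) :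
    esymm (Fin n) K k ∈ Submodule.span K (Set.range (psumProd K n m)) := by
  refine Submodule.span_mono ?_ (esymm_mem_span_psumProd_of_le' K n m hK hk)
  rintro _ ⟨κ, -, rfl⟩
  exact ⟨κ, rfl⟩

end Newton

/-! ### Set-multilinear parts of a product gate, `1, …, #S` invertible -/

section ProductGate

variable {K : Type u} [Field K] {σ : Type v} {ι : Type w}
variable [DecidableEq ι] (blk : σ → ι)

omit [DecidableEq ι] in
/-- **The constant-full part**: `smlProj S' (∏_l (1 + y_l))` lies in the span of the power-sum
generators `wGen` (expand `∏ (1 + y_l) = ∑_j e_j`, drop `j > #S'`, write `e_j` in power sums by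
Newton, project the products part by part). [cite: LimayeSrinivasanTavenas2025, Lemma 20] -/
theorem smlProj_prod_one_add_mem_span_wGen' (L : List (MvPolynomial σ K)) (S' : Finset ι)
    (hK : ∀ i : ℕ, 0 < i → i ≤ S'.card → (i : K) ≠ 0) :
    smlProj blk S' (∏ l : Fin (unitOps L).length, (1 + newtonY L l)) ∈
      Submodule.span K (Set.range (wGen blk L S')) := by
  rw [prod_one_add_newtonY, map_sum]
  refine Submodule.sum_mem _ fun j _ => ?_
  by_cases hj : S'.card < j
  · rw [smlProj_newtonE_eq_zero blk L hj]
    exact Submodule.zero_mem _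
  rw [not_lt] at hj
  -- `e_j ∈ span (psumProd)`, pushed along `aeval y` and then along `smlProj S'`
  have h1 : newtonE L j ∈ Submodule.span K
      (Set.range fun κ : PsumIdx S'.card => ∏ q : Fin κ.1, newtonPow L (κ.2 q)) := by
    have h := esymm_mem_span_psumProd' K (unitOps L).length S'.card hK hj
    have h' : aeval (newtonY L) (esymm (Fin (unitOps L).length) K j) ∈
        Submodule.span K ((aeval (newtonY L)).toLinearMap ''
          Set.range (psumProd K (unitOps L).length S'.card)) := by
      rw [← Submodule.map_span]
      exact Submodule.mem_map_of_mem h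
    refine Submodule.span_mono ?_ h'
    rintro _ ⟨_, ⟨κ, rfl⟩, rfl⟩
    refine ⟨κ, ?_⟩
    simp only [AlgHom.toLinearMap_apply, psumProd, map_prod, aeval_newtonY_psum]
  have h2 : smlProj blk S' (newtonE L j) ∈ Submodule.span K ((smlProj blk S') ''
      Set.range fun κ : PsumIdx S'.card => ∏ q : Fin κ.1, newtonPow L (κ.2 q)) := by
    rw [← Submodule.map_span]
    exact Submodule.mem_map_of_mem h1
  refine Submodule.span_le.2 ?_ (Submodule.span_mono (fun x hx => hx) h2)
  rintro _ ⟨_, ⟨κ, rfl⟩, rfl⟩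
  simp only [SetLike.mem_coe]
  -- project the product part by part
  have h3 := smlProj_list_prod_mem_span blk S' (List.ofFn fun q : Fin κ.1 => newtonPow L (κ.2 q))
  rw [List.prod_ofFn] at h3
  refine Submodule.span_mono ?_ h3
  rintro _ ⟨a, rfl⟩
  have hlen : (List.ofFn fun q : Fin κ.1 => newtonPow L (κ.2 q)).length = κ.1 :=
    List.length_ofFn
  refine ⟨⟨κ, fun x => Fin.cast hlen (a x)⟩, ?_⟩
  unfold wGen partProd
  refine (Fintype.prod_equiv (finCongr hlen)
    (fun q => smlProj blk (blockPart S' a q)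
      (List.ofFn fun q : Fin κ.1 => newtonPow L (κ.2 q))[(q : ℕ)])
    (fun q => smlProj blk (blockPart S' (fun x => Fin.cast hlen (a x)) q) (newtonPow L (κ.2 q)))
    fun q => ?_).symm
  have hp : blockPart S' (fun x => Fin.cast hlen (a x)) (finCongr hlen q) = blockPart S' a q := by
    ext i
    simp only [mem_blockPart, finCongr_apply]
    exact ⟨fun ⟨h, h'⟩ => ⟨h, Fin.cast_injective _ h'⟩, fun ⟨h, h'⟩ => ⟨h, by rw [h']⟩⟩
  rw [hp, List.getElem_ofFn]
  rfl


/-- **Set-multilinear parts of a product gate** (semantic form of LST 2025, Lemma 20 followed by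
Lemma 12): for any list `L` of factors and any block set `S`, `smlProj S (L.prod)` lies in the
`K`-span of the structured generators `newtonGen blk L S`. Multiplicities of repeated factors only
enter through the scalars of the power sums. [cite: LimayeSrinivasanTavenas2025, Lemma 20] -/
theorem smlProj_list_prod_mem_span_newtonGen' (L : List (MvPolynomial σ K)) (S : Finset ι)
    (hK : ∀ i : ℕ, 0 < i → i ≤ S.card → (i : K) ≠ 0) :
    smlProj blk S L.prod ∈ Submodule.span K (Set.range (newtonGen blk L S)) := by
  rw [prod_eq_zeroOps_prod_mul_unitOps_prod, unitOps_prod_eq, mul_left_comm, smlProj_C_mul,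
    C_mul']
  refine Submodule.smul_mem _ _ ?_
  rw [smlProj_mul]
  refine Submodule.sum_mem _ fun S₀ hS₀ => ?_
  -- product of two span members
  have hx := smlProj_list_prod_mem_span blk S₀ (zeroOps L)
  have hy := smlProj_prod_one_add_mem_span_wGen' blk L (S \ S₀) (fun i hi hle =>
    hK i hi (hle.trans (Finset.card_le_card Finset.sdiff_subset)))
  have hxy := Submodule.mul_mem_mul hx hy
  rw [Submodule.span_mul_span] at hxy
  refine Submodule.span_mono ?_ hxy
  rintro _ ⟨_, ⟨a, rfl⟩, _, ⟨g, rfl⟩, rfl⟩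
  exact ⟨⟨⟨S₀, hS₀⟩, a, g⟩, rfl⟩

end ProductGate

/-! ### The engine, `1, …, d` invertible -/

namespace LSTWord

section Induction

variable {K : Type u} [Field K] {d : ℕ} {k : ℕ} {pos : Fin d → Bool}
variable {σ₀ : Type} [Fintype σ₀] {blk₀ : σ₀ → Fin d}
variable {g : σ₀ → MvPolynomial (Σ i : Fin d, BlockVar k pos i) K} {P : ArithCircuit K σ₀}
variable (hg : IsBlockPreserving blk₀ Sigma.fst g)
include hg

omit hg in
open Classical in
/-- **The product-gate step** (LST 2025, Prop. 9 + Claim 16 on one product gate): if `IH p`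
holds with constant `Λ ≥ 1` and `10 d ≤ k`, then every product gate of product-depth
`≤ p + 1` satisfies `relrk_{w|T} ≤ (s+N+1)(d+1)^{5d+1} Λ Φ_{p+1}(#T)`.
[cite: LimayeSrinivasanTavenas2025, Claim 16] -/
theorem relRank_prodGate_le' (hK : ∀ i : ℕ, 0 < i → i ≤ d → (i : K) ≠ 0) {p : ℕ} {Λ : ℝ} (hΛ : 1 ≤ Λ) (hIH : IHolds k pos g P p Λ)
    (hk : 10 * d ≤ k) {j : ℕ} {args : List (ArithCircuit.Operand K σ₀)}
    (hj : P.gates[j]? = some (.prod args)) (hpd : P.gatePD j ≤ p + 1)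
    {T : Finset (Fin d)} (hT : T.Nonempty) :
    relRank K pos T (aeval g (P.gateVal j)) ≤
      ((P.size + Fintype.card σ₀ + 1) * (d + 1) ^ (5 * d + 1) : ℕ) * (Λ * Phi k (p + 1) T.card) := by
  set m := T.card with hm
  have hm1 : 1 ≤ m := Finset.card_pos.2 hT
  have hmd : m ≤ d := by simpa using Finset.card_le_univ T
  have hΛ0 : 0 ≤ Λ := by linarith
  have hjs : j < P.size := (List.getElem?_eq_some_iff.1 hj).1
  -- the operand values
  set L := args.map fun u => aeval g (P.opVal j u) with hLdef
  have hval : aeval g (P.gateVal j) = L.prod := by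
    rw [P.gateVal_of_prod hj, map_list_prod, List.map_map]
    rfl
  have hL : ∀ x ∈ L, InL k pos g P p x := by
    intro x hx
    obtain ⟨u, hu, rfl⟩ := List.mem_map.1 hx
    refine (inL_opVal j u).mono ?_
    have := P.opPD_succ_le_gatePD_of_prod hj hu
    omega
  set Img : Finset (MvPolynomial (Σ i : Fin d, BlockVar k pos i) K) :=
    (Finset.range P.size).image (fun j' => aeval g (P.gateVal j')) ∪ Finset.univ.image g
  have hImg : Img.card ≤ P.size + Fintype.card σ₀ := by
    refine (Finset.card_union_le _ _).trans (add_le_add ?_ ?_)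
    · exact Finset.card_image_le.trans (by simp)
    · exact Finset.card_image_le.trans (by simp)
  have hLImg : ∀ x ∈ L, x ∈ Img ∨ ∃ c : K, x = C c := by
    intro x hx
    obtain ⟨u, hu, rfl⟩ := List.mem_map.1 hx
    cases u with
    | var v => exact Or.inl (Finset.mem_union_right _ (Finset.mem_image.2 ⟨v, Finset.mem_univ _, by simp⟩))
    | const c => exact Or.inr ⟨c, by simp [MvPolynomial.algebraMap_eq]⟩
    | gate j' =>
      simp only [ArithCircuit.opVal_gate]
      split_ifs with h
      · exact Or.inl (Finset.mem_union_left _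
          (Finset.mem_image.2 ⟨j', Finset.mem_range.2 (h.trans hjs), rfl⟩))
      · exact Or.inr ⟨0, by simp⟩
  rw [hval, ← relRank_smlProj pos T]
  by_cases hz : T.card < (zeroOps L).length
  · rw [smlProj_list_prod_eq_zero_of_card_lt_zeroOps _ L hz, relRank_zero]
    exact mul_nonneg (Nat.cast_nonneg _) (mul_nonneg hΛ0 (Phi_pos k _ _).le)
  · have hspan := smlProj_list_prod_mem_span_newtonGen' (Sigma.fst : (Σ i : Fin d, BlockVar k pos i) → Fin d) L T
      (fun i hi hle => hK i hi (hle.trans hmd))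
    refine (relRank_le_sum_of_mem_span pos T hspan).trans ?_
    have hgen := relRank_newtonGen_le hΛ hIH hk L Img hImg hL hLImg T hT
    calc ∑ gi : NewtonIdx L T, relRank K pos T (newtonGen Sigma.fst L T gi)
        ≤ ∑ _gi : NewtonIdx L T, (((P.size + Fintype.card σ₀ + 1) * (m + 1) ^ m : ℕ) : ℝ) *
            (Λ * Phi k (p + 1) m) := Finset.sum_le_sum fun gi _ => hgen gi
      _ = (Fintype.card (NewtonIdx L T)) *
            ((((P.size + Fintype.card σ₀ + 1) * (m + 1) ^ m : ℕ) : ℝ) * (Λ * Phi k (p + 1) m)) := by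
          rw [Finset.sum_const, Finset.card_univ, nsmul_eq_mul]
      _ ≤ ((m + 1) ^ (4 * m + 1) : ℕ) *
            ((((P.size + Fintype.card σ₀ + 1) * (m + 1) ^ m : ℕ) : ℝ) * (Λ * Phi k (p + 1) m)) := by
          refine mul_le_mul_of_nonneg_right ?_
            (mul_nonneg (Nat.cast_nonneg _) (mul_nonneg hΛ0 (Phi_pos k _ _).le))
          exact_mod_cast card_newtonIdx_le L T (not_lt.1 hz)
      _ = (((P.size + Fintype.card σ₀ + 1) * (m + 1) ^ (5 * m + 1) : ℕ) : ℝ) *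
            (Λ * Phi k (p + 1) m) := by
          push_cast; ring
      _ ≤ _ := by
          refine mul_le_mul_of_nonneg_right ?_ (mul_nonneg hΛ0 (Phi_pos k _ _).le)
          have : (m + 1) ^ (5 * m + 1) ≤ (d + 1) ^ (5 * d + 1) :=
            (Nat.pow_le_pow_left (by omega) _).trans (Nat.pow_le_pow_right (by omega) (by omega))
          exact_mod_cast Nat.mul_le_mul_left _ this


/-- **The induction step** (LST 2025, Claim 16, induction on the product-depth): `IH p` with
`Λ ≥ 1` implies `IH (p+1)` with `stepConst · Λ`, provided `10 d ≤ k`.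
[cite: LimayeSrinivasanTavenas2025, Claim 16] -/
theorem iholds_succ' (hK : ∀ i : ℕ, 0 < i → i ≤ d → (i : K) ≠ 0) {p : ℕ} {Λ : ℝ} (hΛ : 1 ≤ Λ) (hIH : IHolds k pos g P p Λ)
    (hk : 10 * d ≤ k) :
    IHolds k pos g P (p + 1) (stepConst P.size (Fintype.card σ₀) d * Λ) := by
  intro x hx T hT
  have hd : 1 ≤ d := by
    have h1 := Finset.card_pos.2 hT
    have h2 : T.card ≤ d := by simpa using Finset.card_le_univ T
    omega
  have hk' : 10 ≤ k := le_trans (by omega) hk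
  have hΛ0 : 0 ≤ Λ := by linarith
  have hbase : Phi k (p + 1) T.card ≤ stepConst P.size (Fintype.card σ₀) d * Λ * Phi k (p + 1) T.card := by
    refine le_mul_of_one_le_left (Phi_pos k _ _).le ?_
    have h1 : (1 : ℝ) ≤ stepConst P.size (Fintype.card σ₀) d := by
      have : 1 ≤ stepConst P.size (Fintype.card σ₀) d := by unfold stepConst; omega
      exact_mod_cast this
    nlinarith
  rcases hx with ⟨j, hj, rfl⟩ | ⟨v, rfl⟩ | ⟨c, rfl⟩
  · set B : ℝ := (((P.size + Fintype.card σ₀ + 1) * (d + 1) ^ (5 * d + 1) : ℕ) : ℝ) * Λ with hB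
    have hB0 : 0 ≤ B := mul_nonneg (Nat.cast_nonneg _) hΛ0
    have h := relRank_gate_le_of_prod_le hg hk' (p + 1) hB0
      (fun j' args hargs hpd T' hT' => by
        have := relRank_prodGate_le' hK hΛ hIH hk hargs hpd hT'
        rwa [← mul_assoc] at this) j hj hT
    refine h.trans (mul_le_mul_of_nonneg_right ?_ (Phi_pos k _ _).le)
    rw [hB, stepConst]
    push_cast
    set A : ℝ := ((P.size : ℝ) + (Fintype.card σ₀ : ℝ) + 1) * ((d : ℝ) + 1) ^ (5 * d + 1) with hA
    have hA0 : 0 ≤ A := by positivity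
    have h1 : 0 ≤ A * Λ := mul_nonneg hA0 hΛ0
    have h2 : (Fintype.card σ₀ : ℝ) ≤ ((Fintype.card σ₀ : ℝ) + 1) * Λ := by
      have : (0 : ℝ) ≤ Fintype.card σ₀ := Nat.cast_nonneg _
      nlinarith
    have hlhs : (P.size : ℝ) * (((P.size : ℝ) + (Fintype.card σ₀ : ℝ) + 1) *
        ((d : ℝ) + 1) ^ (5 * d + 1) * Λ) = P.size * (A * Λ) := by rw [hA]
    have hrhs : (((P.size : ℝ) + 1) * ((P.size : ℝ) + (Fintype.card σ₀ : ℝ) + 1) *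
        ((d : ℝ) + 1) ^ (5 * d + 1) + (Fintype.card σ₀ : ℝ) + 1) * Λ =
        P.size * (A * Λ) + A * Λ + ((Fintype.card σ₀ : ℝ) + 1) * Λ := by rw [hA]; ring
    rw [hlhs, hrhs]
    linarith
  · exact (relRank_var_le hg hk' (p + 1) v T).trans hbase
  · exact (relRank_const_le (p + 1) c hT).trans hbase

/-- **`IH p` holds for every `p`** with the constants `Λ_p` (LST 2025, Claim 16 by induction on
the product-depth). [cite: LimayeSrinivasanTavenas2025, Claim 16] -/
theorem iholds_Lam' (hK : ∀ i : ℕ, 0 < i → i ≤ d → (i : K) ≠ 0) (hk : 10 * d ≤ k) (hd : 1 ≤ d) (p : ℕ) :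
    IHolds k pos g P p (Lam P.size (Fintype.card σ₀) d p) := by
  induction p with
  | zero =>
    simp only [Lam]
    exact iholds_zero hg (le_trans (by omega) hk)
  | succ p ih =>
    simp only [Lam]
    exact iholds_succ' hg hK (one_le_Lam _ _ _ _) ih hk

/-- **Main theorem** (semantic form of LST 2025, Lemma 15 / Claim 16 combined with Prop. 9): for
a block-preserving substitution `g` of the variables of a circuit `P` of product-depth `≤ Δ`
(`s` gates, `N` variables) by block-linear forms on the word blocks, and `10 d ≤ k`, `d ≥ 1`:
`relrk_w(g(P)) ≤ Λ_Δ · 2^{-k d^{μ_Δ}/20}` with `Λ_Δ = stepConst(s,N,d)^Δ (N+1)`.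
[cite: LimayeSrinivasanTavenas2025, Lemma 15] -/
theorem relRank_aeval_eval_le' (hK : ∀ i : ℕ, 0 < i → i ≤ d → (i : K) ≠ 0) (hk : 10 * d ≤ k) (hd : 1 ≤ d) {Δ : ℕ}
    (hΔ : P.productDepth ≤ Δ) :
    relRank K pos Finset.univ (aeval g P.eval) ≤
      Lam P.size (Fintype.card σ₀) d Δ * Phi k Δ d := by
  have hx : InL k pos g P Δ (aeval g P.eval) := by
    rw [P.eval_eq_opVal_output]
    refine (inL_opVal P.size P.output).mono ?_
    rwa [← P.productDepth_eq_opPD_output]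
  have huniv : (Finset.univ : Finset (Fin d)).Nonempty :=
    Finset.univ_nonempty_iff.2 ⟨⟨0, hd⟩⟩
  have h := iholds_Lam' hg hK hk hd Δ _ hx Finset.univ huniv
  rwa [Finset.card_univ, Fintype.card_fin] at h

end Induction

end LSTWord

end Literature.Computability.AlgebraicComplexity
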